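import Mathlib

/-!
# Skew-cut certificate: reality (F4) — a real quadratic-form certificate on the shell controls the
complex coefficients
(instab4 g4 — implementation 2 of the skew-cut X0 certifier, cell `ns-blowup`, 2026-08-26)

HONEST FRAMING (human ruling D-0035): nothing here is a claim about Navier–Stokes blow-up.
WHAT THIS IS NOT: not NS evidence. MODEL lane bookkeeping. The certifier proves a REAL matrix
inequality on the shell `K+1` («`λ_min(Λ_{K+1} − s + Q_K) ≥ MU2`», the (V5) test, `Q_K` real in the
J-real class basis), whereas the SHELL hypothesis of `SkewCutGalerkinTailForm.tail_coercive_of_structure`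
is stated for the COMPLEX coefficients `v_i ∈ 𝕜` of a tail vector:
`MU2 Σ_{i∈sh} |v_i|² ≤ Σ_{i∈sh} δ_i |v_i|² − Re(cross)`. The method note's remark (F4) («J preserves
the class, so the complex form is the real form on real and imaginary parts») is the content of
`shell_ineq_of_real_form`: if `Re(cross) = Re Σ_{i,j∈sh} conj(v_i) q_ij v_j` for a REAL matrix `q`
(locality (F3) + assembly — model-specific) and the real form satisfies
`μ Σ x_i² ≤ Σ δ_i x_i² − Σ x_i q_ij x_j` for all real `x`, then the complex shell inequality holds.

Mathlib only; no new definitions.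
-/

namespace Summit.NavierStokesRegularity.FluidComputer.SkewCutGalerkinReality

open scoped BigOperators ComplexConjugate

variable {ι 𝕜 : Type*} [RCLike 𝕜]

/-- `Re (conj zᵢ · q · zⱼ) = q (Re zᵢ Re zⱼ + Im zᵢ Im zⱼ)` for real `q`. -/
theorem re_conj_mul_real_mul (q : ℝ) (zi zj : 𝕜) :
    RCLike.re (conj zi * (q : 𝕜) * zj) =
      q * (RCLike.re zi * RCLike.re zj + RCLike.im zi * RCLike.im zj) := by
  simp only [RCLike.mul_re, RCLike.mul_im, RCLike.conj_re, RCLike.conj_im, RCLike.ofReal_re,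
    RCLike.ofReal_im]
  ring

/-- `|z|² = (Re z)² + (Im z)²`. -/
theorem norm_sq_eq_re_sq_add_im_sq (z : 𝕜) : ‖z‖ ^ 2 = RCLike.re z ^ 2 + RCLike.im z ^ 2 := by
  rw [← RCLike.normSq_eq_def', RCLike.normSq_apply]; ring

/-- **(F4): a real quadratic-form certificate controls the complex form.** If
`μ Σ_{i∈sh} x_i² ≤ Σ_{i∈sh} δ_i x_i² − Σ_{i∈sh} Σ_{j∈sh} x_i q_ij x_j` for all REAL `x`, then for all
`z : ι → 𝕜`: `μ Σ |z_i|² ≤ Σ δ_i |z_i|² − Re Σ_i Σ_j conj(z_i) q_ij z_j`. -/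
theorem complex_form_ge_of_real_form (sh : Finset ι) (δ : ι → ℝ) (q : ι → ι → ℝ) (μ : ℝ)
    (hreal : ∀ x : ι → ℝ, μ * ∑ i ∈ sh, x i ^ 2 ≤
      ∑ i ∈ sh, δ i * x i ^ 2 - ∑ i ∈ sh, ∑ j ∈ sh, x i * q i j * x j)
    (z : ι → 𝕜) :
    μ * ∑ i ∈ sh, ‖z i‖ ^ 2 ≤ ∑ i ∈ sh, δ i * ‖z i‖ ^ 2 -
      RCLike.re (∑ i ∈ sh, ∑ j ∈ sh, conj (z i) * (q i j : 𝕜) * z j) := by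
  have hx := hreal fun i => RCLike.re (z i)
  have hy := hreal fun i => RCLike.im (z i)
  simp only [norm_sq_eq_re_sq_add_im_sq, map_sum, re_conj_mul_real_mul]
  have e1 : ∑ i ∈ sh, (RCLike.re (z i) ^ 2 + RCLike.im (z i) ^ 2) =
      ∑ i ∈ sh, RCLike.re (z i) ^ 2 + ∑ i ∈ sh, RCLike.im (z i) ^ 2 := Finset.sum_add_distrib
  have e2 : ∑ i ∈ sh, δ i * (RCLike.re (z i) ^ 2 + RCLike.im (z i) ^ 2) =
      ∑ i ∈ sh, δ i * RCLike.re (z i) ^ 2 + ∑ i ∈ sh, δ i * RCLike.im (z i) ^ 2 := by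
    rw [← Finset.sum_add_distrib]; exact Finset.sum_congr rfl fun i _ => by ring
  have e3 : ∑ i ∈ sh, ∑ j ∈ sh, q i j * (RCLike.re (z i) * RCLike.re (z j) +
        RCLike.im (z i) * RCLike.im (z j)) =
      ∑ i ∈ sh, ∑ j ∈ sh, RCLike.re (z i) * q i j * RCLike.re (z j) +
        ∑ i ∈ sh, ∑ j ∈ sh, RCLike.im (z i) * q i j * RCLike.im (z j) := by
    rw [← Finset.sum_add_distrib]
    refine Finset.sum_congr rfl fun i _ => ?_
    rw [← Finset.sum_add_distrib]
    exact Finset.sum_congr rfl fun j _ => by ring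
  rw [e1, e2, e3]
  linarith

/-- **The SHELL hypothesis of `SkewCutGalerkinTailForm.tail_coercive_of_structure` from a real
certificate.** If the cross term of a tail vector equals the complex quadratic form of a REAL shell
matrix `q` in the shell coefficients `v_i` (locality + assembly, model-specific), and the real form
`x ↦ Σ δ_i x_i² − xᵀ q x` dominates `MU2 |x|²` (the certifier's test, `δ_i = a − ℓ_i − s`), then
`MU2 Σ_{i∈sh} |v_i|² ≤ Σ_{i∈sh} δ_i |v_i|² − Re(cross)`. -/
theorem shell_ineq_of_real_form (sh : Finset ι) (δ : ι → ℝ) (q : ι → ι → ℝ) (MU2 : ℝ)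
    (hreal : ∀ x : ι → ℝ, MU2 * ∑ i ∈ sh, x i ^ 2 ≤
      ∑ i ∈ sh, δ i * x i ^ 2 - ∑ i ∈ sh, ∑ j ∈ sh, x i * q i j * x j)
    (v : ι → 𝕜) (cross : ℝ)
    (hcross : cross = RCLike.re (∑ i ∈ sh, ∑ j ∈ sh, conj (v i) * (q i j : 𝕜) * v j)) :
    MU2 * ∑ i ∈ sh, ‖v i‖ ^ 2 ≤ ∑ i ∈ sh, δ i * ‖v i‖ ^ 2 - cross := by
  rw [hcross]; exact complex_form_ge_of_real_form sh δ q MU2 hreal v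

end Summit.NavierStokesRegularity.FluidComputer.SkewCutGalerkinReality
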